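import Mathlib
import Summits.AtomisticToContinuum.Crystallization.Theses.ChessboardParticlePlanes
import Summits.AtomisticToContinuum.Crystallization.Theorems.ChessboardParticlePlanesLjLaminarWindowsOneWindow
import HarnessLib

/-!
# The one-window residual of `LjLaminarWindows` needs no threshold radius — line `Sketch`,
skeleton rev. 19 (lead c12), crux stmt-AtomisticToContinuum-6711

The tree theorem `LjLaminarWindows_iff_oneWindow` (rev. 17/18, lead c11) makes the crux `LjLaminarWindows` of
route `ChessboardParticlePlanes` equivalent to its own laminarity clause S9: "for every sequence of
Lennard-Jones ground states and every `η > 0` THERE IS `L₀` such that for every `L ≥ L₀`, frequently in `N`,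
some particle-centred closed `L`-window is `η`-laminar (some linear isometry `A`, some `3/4`-separated height
set `T`)".  Laminarity of the closed `L'`-ball around `xᵢ` is inherited by the concentric closed `L`-ball for
`L ≤ L'` (same `A`, same `T`), so the threshold `L₀` is idle: S9 is equivalent to the all-scales form
S9♭ "for every ground-state sequence, every `η > 0` and EVERY radius `L`, frequently in `N`, some
particle-centred closed `L`-window is `η`-laminar" (`oneWindowAllScales_of_oneWindow`,
`oneWindow_of_oneWindowAllScales`), and so is the crux (`LjLaminarWindows_iff_oneWindowAllScales`).
The negation any refutation must exhibit is therefore: ONE ground-state sequence, ONE thickness `η > 0` and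
ONE radius `L` such that, for all large `N`, NO particle-centred closed `L`-window is `η`-laminar.
-/

noncomputable section

open Filter
open Literature.MathematicalPhysics.StatisticalMechanics

namespace Summit.AtomisticToContinuum.Crystallization.Theorems.LjLaminarWindowsSketch

/-- **S9 ⇒ S9♭: the threshold radius is idle.** Given `η` and any radius `L`, apply the one-window residual at
`L' = max L L₀ ≥ L₀`; the laminar closed `L'`-window around `xᵢ` contains the closed `L`-window around the same
`xᵢ`, which is therefore laminar for the same `A` and `T`. [folklore] -/
theorem oneWindowAllScales_of_oneWindow
    (hOne : ∀ x : (N : ℕ) → (Fin N → EuclideanSpace ℝ (Fin 3)),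
      (∀ N, IsGroundState lennardJones (x N)) →
      ∀ η : ℝ, 0 < η → ∃ L₀ : ℝ, ∀ L : ℝ, L₀ ≤ L → ∃ᶠ N in Filter.atTop,
        ∃ (i : Fin N) (A : EuclideanSpace ℝ (Fin 3) →ₗᵢ[ℝ] EuclideanSpace ℝ (Fin 3)) (T : Set ℝ),
          (∀ t ∈ T, ∀ t' ∈ T, t ≠ t' → (3 : ℝ) / 4 ≤ |t - t'|) ∧
          (∀ j : Fin N, dist (x N j) (x N i) ≤ L → ∃ t ∈ T, |(A (x N j - x N i)) 2 - t| ≤ η)) :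
    ∀ x : (N : ℕ) → (Fin N → EuclideanSpace ℝ (Fin 3)),
      (∀ N, IsGroundState lennardJones (x N)) →
      ∀ η : ℝ, 0 < η → ∀ L : ℝ, ∃ᶠ N in Filter.atTop,
        ∃ (i : Fin N) (A : EuclideanSpace ℝ (Fin 3) →ₗᵢ[ℝ] EuclideanSpace ℝ (Fin 3)) (T : Set ℝ),
          (∀ t ∈ T, ∀ t' ∈ T, t ≠ t' → (3 : ℝ) / 4 ≤ |t - t'|) ∧
          (∀ j : Fin N, dist (x N j) (x N i) ≤ L → ∃ t ∈ T, |(A (x N j - x N i)) 2 - t| ≤ η) := by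
  intro x hx η hη L
  obtain ⟨L₀, hL₀⟩ := hOne x hx η hη
  refine (hL₀ (max L L₀) (le_max_right _ _)).mono ?_
  rintro N ⟨i, A, T, hT, hlam⟩
  exact ⟨i, A, T, hT, fun j hj => hlam j (hj.trans (le_max_left _ _))⟩

/-- **S9♭ ⇒ S9** (take `L₀ = 0`, or anything). [folklore] -/
theorem oneWindow_of_oneWindowAllScales
    (hAll : ∀ x : (N : ℕ) → (Fin N → EuclideanSpace ℝ (Fin 3)),
      (∀ N, IsGroundState lennardJones (x N)) →
      ∀ η : ℝ, 0 < η → ∀ L : ℝ, ∃ᶠ N in Filter.atTop,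
        ∃ (i : Fin N) (A : EuclideanSpace ℝ (Fin 3) →ₗᵢ[ℝ] EuclideanSpace ℝ (Fin 3)) (T : Set ℝ),
          (∀ t ∈ T, ∀ t' ∈ T, t ≠ t' → (3 : ℝ) / 4 ≤ |t - t'|) ∧
          (∀ j : Fin N, dist (x N j) (x N i) ≤ L → ∃ t ∈ T, |(A (x N j - x N i)) 2 - t| ≤ η)) :
    ∀ x : (N : ℕ) → (Fin N → EuclideanSpace ℝ (Fin 3)),
      (∀ N, IsGroundState lennardJones (x N)) →
      ∀ η : ℝ, 0 < η → ∃ L₀ : ℝ, ∀ L : ℝ, L₀ ≤ L → ∃ᶠ N in Filter.atTop,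
        ∃ (i : Fin N) (A : EuclideanSpace ℝ (Fin 3) →ₗᵢ[ℝ] EuclideanSpace ℝ (Fin 3)) (T : Set ℝ),
          (∀ t ∈ T, ∀ t' ∈ T, t ≠ t' → (3 : ℝ) / 4 ≤ |t - t'|) ∧
          (∀ j : Fin N, dist (x N j) (x N i) ≤ L → ∃ t ∈ T, |(A (x N j - x N i)) 2 - t| ≤ η) :=
  fun x hx η hη => ⟨0, fun L _ => hAll x hx η hη L⟩

/-- **`LjLaminarWindows` ↔ one laminar window at EVERY scale, frequently in `N` (unconditional).** The crux
of route `ChessboardParticlePlanes` (stmt-AtomisticToContinuum-6711) is equivalent to S9♭: for every sequence of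
Lennard-Jones ground states, every `η > 0` and every radius `L`, frequently in `N`, some particle `i`, linear
isometry `A` and `3/4`-separated `T ⊂ ℝ` put every particle of the closed `L`-ball around `xᵢ` within `η` of `T`
in the rotated third coordinate.  (`LjLaminarWindows_iff_oneWindow` composed with the two lemmas above.)
[folklore] -/
theorem LjLaminarWindows_iff_oneWindowAllScales :
    Summit.AtomisticToContinuum.Crystallization.Theses.ChessboardParticlePlanes.LjLaminarWindows ↔
    (∀ x : (N : ℕ) → (Fin N → EuclideanSpace ℝ (Fin 3)),
      (∀ N, IsGroundState lennardJones (x N)) →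
      ∀ η : ℝ, 0 < η → ∀ L : ℝ, ∃ᶠ N in Filter.atTop,
        ∃ (i : Fin N) (A : EuclideanSpace ℝ (Fin 3) →ₗᵢ[ℝ] EuclideanSpace ℝ (Fin 3)) (T : Set ℝ),
          (∀ t ∈ T, ∀ t' ∈ T, t ≠ t' → (3 : ℝ) / 4 ≤ |t - t'|) ∧
          (∀ j : Fin N, dist (x N j) (x N i) ≤ L → ∃ t ∈ T, |(A (x N j - x N i)) 2 - t| ≤ η)) :=
  ⟨fun h => oneWindowAllScales_of_oneWindow (LjLaminarWindows_iff_oneWindow.1 h),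
    fun h => LjLaminarWindows_iff_oneWindow.2 (oneWindow_of_oneWindowAllScales h)⟩

/-- **Closing recipe for the all-scales residual**: S9♭ proves the crux. [folklore] -/
theorem LjLaminarWindows_of_oneWindowAllScales
    (hAll : ∀ x : (N : ℕ) → (Fin N → EuclideanSpace ℝ (Fin 3)),
      (∀ N, IsGroundState lennardJones (x N)) →
      ∀ η : ℝ, 0 < η → ∀ L : ℝ, ∃ᶠ N in Filter.atTop,
        ∃ (i : Fin N) (A : EuclideanSpace ℝ (Fin 3) →ₗᵢ[ℝ] EuclideanSpace ℝ (Fin 3)) (T : Set ℝ),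
          (∀ t ∈ T, ∀ t' ∈ T, t ≠ t' → (3 : ℝ) / 4 ≤ |t - t'|) ∧
          (∀ j : Fin N, dist (x N j) (x N i) ≤ L → ∃ t ∈ T, |(A (x N j - x N i)) 2 - t| ≤ η)) :
    Summit.AtomisticToContinuum.Crystallization.Theses.ChessboardParticlePlanes.LjLaminarWindows :=
  LjLaminarWindows_iff_oneWindowAllScales.2 hAll

end Summit.AtomisticToContinuum.Crystallization.Theorems.LjLaminarWindowsSketch

end
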